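import Literature.AlgebraicGeometry.HodgeTheory.SimpleAbelianThreefoldQuadraticEndPowersHodgeClasses
import Summits.HodgeConjecture.CorCM.LefschetzAlgebraCMField
import HarnessLib

/-!
# Ribet type `(g − 1, 1)`: `Lie Hg(H¹A) = 𝔲_K(H¹A, ψ)`, Hodge = Lefschetz, `dim MT(H¹A) = g² + 1`
# (Ribet 1983 Thm. 3 «`Hg(A) = Lf(A)`»; Moonen–Zarhin 1999 (2.3) Type IV(1,1) «`Hg(X) = U_F(V, ψ)`»)

COR-CM (cell `pub-hodgecm2`, seat `b27` gen 46, count-neutral Mumford–Tate-rank ladder; theorems only, no definition, no named fact;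
UNCONDITIONAL — nothing here uses or asserts HC_CM).  TYPE IV ENTERS THE LADDER WITH AN EXACT RUNG.  Let `A` be a complex abelian
variety of dimension `g ≥ 3` with `φ : A → A`, `φ ∘ φ = −d` (`d > 0`), `dim_ℚ End⁰A = 2` (so `End⁰A = ℚ(√−d)`) and multiplicity ONE at
`i√d` or at `−i√d` on `H^{1,0}(A)` (Ribet's coprime pair `(n′, n″) = (g − 1, 1)`).  The tree's abstract unitary Θ-subalgebra theorem
`UnitaryTheta.mem_hodgeLie_iff_commute_and_skew` (`Motives/HodgeThetaSubalgebraUnitary`, cell `pub-hodge-ring2`), fed with the rational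
datum `φ^*_ℚ` of `HodgeTheory/RibetTypeOnePowersHodgeClasses` (square `−d`, `End_Hdg(H¹) = ℚ + ℚφ^*_ℚ`, multiplicities), gives:

* **`mem_hodgeLie_iff_commute_and_skew_of_ribetTypeOne`** — `X ∈ Lie Hg(H¹A) ⟺ X φ^*_ℚ = φ^*_ℚ X ∧ X` is `ψ`-skew: `Lie Hg(H¹A) = 𝔲_K(H¹A, ψ)`;
* **`hodgeLie_eq_lefschetz_of_ribetTypeOne`** — HODGE = LEFSCHETZ: `Lie Hg(H¹A) = C(End_Hdg(H¹A)) ∩ 𝔰𝔭(ψ)` for every polarization;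
* **`mtRank_hodge_one_of_ribetTypeOne`** — when moreover `End⁰A` is a field that is not totally real (automatic for simple `A` of odd
  dimension): **`dim_ℚ Lie Hg(H¹A) = g²` and `t = dim MT(H¹A) = g² + 1`** (the unitary count `dim Lef(ψ) = (dim A)²` of
  `CorCM/LefschetzAlgebraCMField`, `End⁰A` being a CM field by the tree's Riemann dichotomy); primed ladder form with an arbitrary
  smooth-projective witness;
* **`mtRank_hodge_one_of_isSimple_threefold_of_finrank_endAlgebra_eq_two`** — Moonen–Zarhin's row IV(1,1) for THREEFOLDS: a simple abelian
  threefold whose endomorphism algebra is (an imaginary) quadratic (field) has **`t = 10`, `dim Lie Hg(H¹A) = 9`** (`Hg = U(2,1)`-form) and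
  Hodge = Lefschetz — the multiplicities are `(2, 1)` by Shimura's Prop. 14 (`HodgeTheory/SimpleAbelianThreefoldQuadraticEndPowersHodgeClasses`).

## References
* [Ribet1983] K. A. Ribet, *Hodge classes on certain types of abelian varieties*, Amer. J. Math. 105 (1983), Thm. 0, Thm. 3.
* [MoonenZarhin1999LowDim] B. Moonen, Yu. G. Zarhin, Math. Ann. 315 (1999), §2 (2.3) Type IV(1,1), (2.4), (2.5).
* [Milne1999LefschetzClasses] J. S. Milne, Compositio Math. 117 (1999), §2 and Summary (`U(φ)` for type IV).
* [Gordon1997] B. B. Gordon, *A survey of the Hodge conjecture for abelian varieties* (1997), Thm. 6.3 (3).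
* [Shimura1963AnalyticFamilies] G. Shimura, Ann. of Math. 78 (1963), §4 Prop. 14.
-/

noncomputable section

open scoped TensorProduct
open CategoryTheory Module NumberField

namespace Summit.HodgeConjecture.CorCM

open Literature.AlgebraicGeometry.Motives
open Literature.AlgebraicGeometry.Motives.AbelianVariety
open Literature.AlgebraicGeometry.Motives.HodgeStructure
open Literature.AlgebraicGeometry.HodgeTheory
open Literature.AlgebraicGeometry.ComplexMultiplication

variable [HodgeTensorFacts.{0, 0}] {A : AbelianVariety ℂ}

/-! ## §1 `Lie Hg(H¹A) = 𝔲_K(H¹A, ψ)` for Ribet type `(g − 1, 1)` -/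

/-- **`Lie Hg(H¹A) = 𝔲_K(H¹A, ψ)` for Ribet type `(g − 1, 1)`** (`g = dim A ≥ 3`, `φ ∘ φ = −d`, `dim_ℚ End⁰A = 2`, multiplicity one at
`± i√d`): a rational operator lies in `Lie Hg(H¹A)` iff it commutes with `φ^*_ℚ` and is `ψ`-skew — the tree's
`UnitaryTheta.mem_hodgeLie_iff_commute_and_skew` with the data of `RibetTypeOnePowersHodgeClasses` (`(φ^*_ℚ)² = −d`,
`End_Hdg(H¹) = ℚ + ℚφ^*_ℚ`, `dim(W_μ ∩ H^{0,1}) = 1`, `dim(W_μ ∩ H^{1,0}) = g − 1 ≥ 2` for the right root `μ` of `−d`).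
[cite: Ribet1983, Thm. 3] [cite: MoonenZarhin1999LowDim, §2 (2.3)] [cite: Gordon1997, Thm. 6.3 (3)] -/
theorem mem_hodgeLie_iff_commute_and_skew_of_ribetTypeOne (hHD : exists_isReal_hodgeModel) (hI : hodgePQ_independent_of_hodgeModel)
    (φ : A ⟶ A) {d : ℕ} (hd : 0 < d) (hφ : φ ≫ φ = -(d • 𝟙 A)) (hE2 : Module.finrank ℚ A.endAlgebra = 2)
    (h1 : eigenMultiplicity A φ (Complex.I * (Real.sqrt d : ℂ)) = 1 ∨ eigenMultiplicity A φ (-(Complex.I * (Real.sqrt d : ℂ))) = 1)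
    (hdim : 3 ≤ A.dim) [Module.Finite ℚ (bettiCohomology A.X 1)]
    (ψ : (BettiUniverse.hodge hHD (AbelianVariety.isSmoothProjective_holds (A := A)) 1).Polarization)
    (X : Module.End ℚ (bettiCohomology A.X 1)) :
    X ∈ (BettiUniverse.hodge hHD (AbelianVariety.isSmoothProjective_holds (A := A)) 1).hodgeLie ↔
      X * (bettiCohomology.map φ.hom.hom.hom 1).hom = (bettiCohomology.map φ.hom.hom.hom 1).hom * X ∧
        ∀ v w, ψ.form (X v) w + ψ.form v (X w) = 0 := by
  classical
  have hX : IsSmoothProjective A.dim A.X := AbelianVariety.isSmoothProjective_holds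
  have heff := BettiUniverse.hodge_isEffective hHD hX 1
  set φQ : Module.End ℚ (bettiCohomology A.X 1) := (bettiCohomology.map φ.hom.hom.hom 1).hom with hφQ
  have hφE : φQ ∈ (BettiUniverse.hodge hHD (AbelianVariety.isSmoothProjective_holds (A := A)) 1).endAlg := by
    have h := Literature.AlgebraicGeometry.HodgeTheory.unop_bettiRep_mem_endAlg hHD hI (AbelianVariety.endAlgebra.of A φ)
    rwa [bettiRep_of, MulOpposite.unop_op] at h
  have hφ2 : φQ * φQ = -((d : ℚ) • 1) := bettiMapHom_mul_self hφ
  have hdQ : (0 : ℚ) < d := Nat.cast_pos.2 hd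
  have hE := exists_eq_smul_one_add_smul_bettiMapHom hHD hI hd hφ hE2 (by omega)
  have hsum := eigenMultiplicity_add_eigenMultiplicity_neg_eq_dim A φ hd hφ
  have hμ₀ : (Complex.I * (Real.sqrt d : ℂ)) ^ 2 = -((d : ℚ) : ℂ) := by
    rw [mul_pow, Complex.I_sq, ← Complex.ofReal_pow, Real.sq_sqrt (Nat.cast_nonneg d), Complex.ofReal_natCast,
      Rat.cast_natCast, neg_one_mul]
  have hconj₀ : starRingEnd ℂ (Complex.I * (Real.sqrt d : ℂ)) = -(Complex.I * (Real.sqrt d : ℂ)) := by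
    rw [map_mul, Complex.conj_I, Complex.conj_ofReal, neg_mul]
  obtain ⟨μ, hμ, hm1, hm2⟩ : ∃ μ : ℂ, μ ^ 2 = -((d : ℚ) : ℂ) ∧
      eigenMultiplicity A φ (starRingEnd ℂ μ) = 1 ∧ 2 ≤ eigenMultiplicity A φ μ := by
    rcases h1 with h | h
    · exact ⟨-(Complex.I * (Real.sqrt d : ℂ)), by rw [neg_sq, hμ₀], by rw [map_neg, hconj₀, neg_neg, h], by omega⟩
    · exact ⟨Complex.I * (Real.sqrt d : ℂ), hμ₀, by rw [hconj₀, h], by omega⟩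
  have h1' : Module.finrank ℂ ↥(Module.End.eigenspace (φQ.baseChange ℂ) μ ⊓
      (BettiUniverse.hodge hHD (AbelianVariety.isSmoothProjective_holds (A := A)) 1).piece 0 1) = 1 := by
    rw [hφQ, finrank_eigenspace_inf_piece_zeroOne_eq_eigenMultiplicity_conj hHD hI φ μ, hm1]
  have h2' : 2 ≤ Module.finrank ℂ ↥(Module.End.eigenspace (φQ.baseChange ℂ) μ ⊓
      (BettiUniverse.hodge hHD (AbelianVariety.isSmoothProjective_holds (A := A)) 1).piece 1 0) := by
    rw [hφQ, finrank_eigenspace_inf_piece_oneZero_eq_eigenMultiplicity hHD hI φ μ]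
    exact hm2
  exact UnitaryTheta.mem_hodgeLie_iff_commute_and_skew _ Nat.cast_one heff ψ hφE hdQ hφ2 hE hμ h1' h2' X

/-! ## §2 Hodge = Lefschetz -/

/-- **Hodge = Lefschetz for Ribet type `(g − 1, 1)`**: `Lie Hg(H¹A) = C(End_Hdg(H¹A)) ∩ 𝔰𝔭(ψ)` for every polarization `ψ` — since
`End_Hdg(H¹A) = ℚ + ℚφ^*_ℚ`, commuting with `φ^*_ℚ` is commuting with every Hodge endomorphism (Ribet: `Hg(A) = Lf(A)`; Milne's `U(φ)`).
[cite: Ribet1983, Thm. 3] [cite: Milne1999LefschetzClasses, §2 and Summary] [cite: MoonenZarhin1999LowDim, §2 (2.3)] -/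
theorem hodgeLie_eq_lefschetz_of_ribetTypeOne (hHD : exists_isReal_hodgeModel) (hI : hodgePQ_independent_of_hodgeModel)
    (φ : A ⟶ A) {d : ℕ} (hd : 0 < d) (hφ : φ ≫ φ = -(d • 𝟙 A)) (hE2 : Module.finrank ℚ A.endAlgebra = 2)
    (h1 : eigenMultiplicity A φ (Complex.I * (Real.sqrt d : ℂ)) = 1 ∨ eigenMultiplicity A φ (-(Complex.I * (Real.sqrt d : ℂ))) = 1)
    (hdim : 3 ≤ A.dim) [Module.Finite ℚ (bettiCohomology A.X 1)]
    (ψ : (BettiUniverse.hodge hHD (AbelianVariety.isSmoothProjective_holds (A := A)) 1).Polarization) :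
    (BettiUniverse.hodge hHD (AbelianVariety.isSmoothProjective_holds (A := A)) 1).hodgeLie =
      Subalgebra.toSubmodule (Subalgebra.centralizer ℚ
          ((BettiUniverse.hodge hHD (AbelianVariety.isSmoothProjective_holds (A := A)) 1).endAlg :
            Set (Module.End ℚ (bettiCohomology A.X 1)))) ⊓ ψ.form.skewAdjointSubmodule := by
  classical
  have hφE : (bettiCohomology.map φ.hom.hom.hom 1).hom ∈
      (BettiUniverse.hodge hHD (AbelianVariety.isSmoothProjective_holds (A := A)) 1).endAlg := by
    have h := Literature.AlgebraicGeometry.HodgeTheory.unop_bettiRep_mem_endAlg hHD hI (AbelianVariety.endAlgebra.of A φ)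
    rwa [bettiRep_of, MulOpposite.unop_op] at h
  have hE := exists_eq_smul_one_add_smul_bettiMapHom hHD hI hd hφ hE2 (by omega)
  ext X
  rw [mem_hodgeLie_iff_commute_and_skew_of_ribetTypeOne hHD hI φ hd hφ hE2 h1 hdim ψ X, Submodule.mem_inf,
    Subalgebra.mem_toSubmodule, Subalgebra.mem_centralizer_iff, LinearMap.mem_skewAdjointSubmodule]
  have hskew_iff : (∀ v w, ψ.form (X v) w + ψ.form v (X w) = 0) ↔ ψ.form.IsSkewAdjoint X := by
    refine ⟨fun h v w => ?_, fun h v w => ?_⟩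
    · rw [Pi.neg_apply, map_neg, ← add_eq_zero_iff_eq_neg]
      exact h v w
    · have h' := h v w
      rw [Pi.neg_apply, map_neg, ← add_eq_zero_iff_eq_neg] at h'
      exact h'
  rw [hskew_iff]
  refine ⟨fun ⟨hc, hs⟩ => ⟨fun a ha => ?_, hs⟩, fun ⟨hc, hs⟩ => ⟨(hc _ hφE).symm, hs⟩⟩
  obtain ⟨x, y, rfl⟩ := hE a ha
  rw [add_mul, mul_add, smul_mul_assoc, smul_mul_assoc, mul_smul_comm, mul_smul_comm, one_mul, mul_one, ← hc]

/-! ## §3 The rung `t = g² + 1` -/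

omit [HodgeTensorFacts.{0, 0}] in
/-- `End⁰A` is a CM field when it is a field that is not totally real (the tree's Riemann dichotomy
`isTotallyReal_or_isCMField_endField_of_riemann`, Riemann's theorem discharged). [cite: MoonenZarhin1999LowDim, §2 (2.3)] -/
private theorem isCMField_endField_of_not_isTotallyReal (hF : IsField A.endAlgebra) (h0 : 0 < A.dim)
    (hnR : ¬ IsTotallyReal (EndField A hF)) : IsCMField (EndField A hF) :=
  (isTotallyReal_or_isCMField_endField_of_riemann hF deligneMilne1982_Thm_6_20_full_holds h0).resolve_left hnR

/-- **THE RUNG `t = dim MT(H¹A) = g² + 1`, `dim Lie Hg(H¹A) = g²`, for Ribet type `(g − 1, 1)`** with `End⁰A` a field that is not totally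
real (then `End⁰A = ℚ(√−d)` is a CM field and `dim Lef(ψ) = (dim A)²` by `CorCM/LefschetzAlgebraCMField`; Hodge = Lefschetz by §2).
Moonen–Zarhin (2.4): `Hg = U_F(V, ψ)` of dimension `g²`. [cite: Ribet1983, Thm. 3] [cite: MoonenZarhin1999LowDim, §2 (2.3) and (2.4)]
[cite: Milne1999LefschetzClasses, §2 and Summary] -/
theorem mtRank_hodge_one_of_ribetTypeOne (hF : IsField A.endAlgebra) (hnR : ¬ IsTotallyReal (EndField A hF))
    (φ : A ⟶ A) {d : ℕ} (hd : 0 < d) (hφ : φ ≫ φ = -(d • 𝟙 A)) (hE2 : Module.finrank ℚ A.endAlgebra = 2)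
    (h1 : eigenMultiplicity A φ (Complex.I * (Real.sqrt d : ℂ)) = 1 ∨ eigenMultiplicity A φ (-(Complex.I * (Real.sqrt d : ℂ))) = 1)
    (hdim : 3 ≤ A.dim) [Module.Finite ℚ (bettiCohomology A.X 1)] :
    (BettiUniverse.hodge exists_isReal_hodgeModel_holds (AbelianVariety.isSmoothProjective_holds (A := A)) 1).mtRank = A.dim * A.dim + 1 ∧
      Module.finrank ℚ (BettiUniverse.hodge exists_isReal_hodgeModel_holds (AbelianVariety.isSmoothProjective_holds (A := A)) 1).hodgeLie =
        A.dim * A.dim := by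
  classical
  have h0 : 0 < A.dim := by omega
  haveI : IsCMField (EndField A hF) := isCMField_endField_of_not_isTotallyReal hF h0 hnR
  obtain ⟨ψ⟩ := BettiUniverse.hodge_isPolarizable exists_isReal_hodgeModel_holds (AbelianVariety.isSmoothProjective_holds (A := A)) 1
  have hK : Module.finrank ℚ (EndField A hF) = 2 := by rw [EndField.finrank_eq hF, hE2]
  obtain ⟨hLef, -⟩ := finrank_lefschetz_eq_sq_of_isCMField_of_finrank_eq_two h0 (EndField.toEndAlgebra hF).toRingHom
    (EndField.toEndAlgebra hF).bijective hK ψ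
  have hHL := hodgeLie_eq_lefschetz_of_ribetTypeOne exists_isReal_hodgeModel_holds hodgePQ_independent_of_hodgeModel_holds φ hd hφ
    hE2 h1 hdim ψ
  have hfin : Module.finrank ℚ (BettiUniverse.hodge exists_isReal_hodgeModel_holds
      (AbelianVariety.isSmoothProjective_holds (A := A)) 1).hodgeLie = A.dim * A.dim := by rw [hHL, hLef]
  exact ⟨by rw [mtRank_hodge_one_eq_finrank_hodgeLie_add_one (AbelianVariety.isSmoothProjective_holds (A := A)) h0, hfin], hfin⟩

/-- The rung with an arbitrary smooth-projective witness `hX : IsSmoothProjective n A.X` (the form used on the ladder).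
[cite: Ribet1983, Thm. 3] [cite: MoonenZarhin1999LowDim, §2 (2.3) and (2.4)] -/
theorem mtRank_hodge_one_of_ribetTypeOne' {n : ℕ} (hX : IsSmoothProjective n A.X) (hF : IsField A.endAlgebra)
    (hnR : ¬ IsTotallyReal (EndField A hF)) (φ : A ⟶ A) {d : ℕ} (hd : 0 < d) (hφ : φ ≫ φ = -(d • 𝟙 A))
    (hE2 : Module.finrank ℚ A.endAlgebra = 2)
    (h1 : eigenMultiplicity A φ (Complex.I * (Real.sqrt d : ℂ)) = 1 ∨ eigenMultiplicity A φ (-(Complex.I * (Real.sqrt d : ℂ))) = 1)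
    (hdim : 3 ≤ A.dim) :
    haveI := BettiUniverse.finite hX 1
    (BettiUniverse.hodge exists_isReal_hodgeModel_holds hX 1).mtRank = A.dim * A.dim + 1 ∧
      Module.finrank ℚ (BettiUniverse.hodge exists_isReal_hodgeModel_holds hX 1).hodgeLie = A.dim * A.dim := by
  have hn : A.dim = n := schemeDim_eq_holds hX
  subst hn
  haveI := BettiUniverse.finite hX 1
  exact mtRank_hodge_one_of_ribetTypeOne hF hnR φ hd hφ hE2 h1 hdim

/-! ## §4 Threefolds with (imaginary) quadratic endomorphism field: `t = 10`, Hodge = Lefschetz -/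

/-- **A SIMPLE abelian THREEFOLD whose endomorphism algebra has `ℚ`-dimension `2` has `dim MT(H¹A) = 10` and `dim Lie Hg(H¹A) = 9`**
(Moonen–Zarhin (2.3) Type IV(1,1): `End⁰A = F` imaginary quadratic, `Hg(A) = U_F(V, ψ)`, a form of `U(2,1)` of dimension `9`):
`End⁰A` is a quadratic field (Mumford §19), not totally real (`[End⁰A:ℚ] ∣ dim A` fails, `2 ∤ 3`), `φ ∘ φ = −d` for some `φ`, and the
multiplicities on `H^{1,0}` are `(2, 1)` (both positive on a simple `A`, Shimura Prop. 14), so §3 applies with `g = 3`.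
[cite: MoonenZarhin1999LowDim, §2 (2.3), (2.4) and (2.5)] [cite: Shimura1963AnalyticFamilies, §4 Prop. 14] [cite: Ribet1983, Thm. 3] -/
theorem mtRank_hodge_one_of_isSimple_threefold_of_finrank_endAlgebra_eq_two {n : ℕ} (hX : IsSmoothProjective n A.X)
    (hA : A.IsSimple) (h3 : A.dim = 3) (hE2 : Module.finrank ℚ A.endAlgebra = 2) :
    haveI := BettiUniverse.finite hX 1
    (BettiUniverse.hodge exists_isReal_hodgeModel_holds hX 1).mtRank = 10 ∧
      Module.finrank ℚ (BettiUniverse.hodge exists_isReal_hodgeModel_holds hX 1).hodgeLie = 9 := by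
  classical
  have h0 : 0 < A.dim := by omega
  have hF : IsField A.endAlgebra := AbelianVariety.isField_endAlgebra_of_isSimple_of_finrank_eq_two hA h0 hE2
  have hnR : ¬ IsTotallyReal (EndField A hF) := fun hR => by
    have h := finrank_endAlgebra_dvd_dim_of_isField_of_isTotallyReal hF h0 hR
    rw [hE2, h3] at h
    omega
  obtain ⟨a, q, hq, ha⟩ := AbelianVariety.exists_mul_self_eq_neg_of_finrank_eq_two h0 hE2 hF hnR
  obtain ⟨φ, d, hd, hφ⟩ := AbelianVariety.exists_hom_comp_self_eq_neg A hq ha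
  have hsum := eigenMultiplicity_add_eigenMultiplicity_neg_eq_dim A φ hd hφ
  have hpos := AbelianVariety.eigenMultiplicity_pos_of_isSimple A hA φ hd hφ (by omega)
  have h1 : eigenMultiplicity A φ (Complex.I * (Real.sqrt d : ℂ)) = 1 ∨
      eigenMultiplicity A φ (-(Complex.I * (Real.sqrt d : ℂ))) = 1 := by omega
  have h := mtRank_hodge_one_of_ribetTypeOne' hX hF hnR φ hd hφ hE2 h1 (by omega)
  rw [h3] at h
  exact h

/-- **Hodge = Lefschetz for a simple abelian threefold with quadratic endomorphism field**: `Lie Hg(H¹A) = C(End_Hdg(H¹A)) ∩ 𝔰𝔭(ψ)` for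
every polarization. [cite: MoonenZarhin1999LowDim, §2 (2.3)] [cite: Ribet1983, Thm. 3] [cite: Milne1999LefschetzClasses, §2 and Summary] -/
theorem hodgeLie_eq_lefschetz_of_isSimple_threefold_of_finrank_endAlgebra_eq_two {n : ℕ} (hX : IsSmoothProjective n A.X)
    (hA : A.IsSimple) (h3 : A.dim = 3) (hE2 : Module.finrank ℚ A.endAlgebra = 2) [Module.Finite ℚ (bettiCohomology A.X 1)]
    (ψ : (BettiUniverse.hodge exists_isReal_hodgeModel_holds hX 1).Polarization) :
    (BettiUniverse.hodge exists_isReal_hodgeModel_holds hX 1).hodgeLie =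
      Subalgebra.toSubmodule (Subalgebra.centralizer ℚ
          ((BettiUniverse.hodge exists_isReal_hodgeModel_holds hX 1).endAlg : Set (Module.End ℚ (bettiCohomology A.X 1)))) ⊓
        ψ.form.skewAdjointSubmodule := by
  classical
  have hn : A.dim = n := schemeDim_eq_holds hX
  subst hn
  have h0 : 0 < A.dim := by omega
  have hF : IsField A.endAlgebra := AbelianVariety.isField_endAlgebra_of_isSimple_of_finrank_eq_two hA h0 hE2
  have hnR : ¬ IsTotallyReal (EndField A hF) := fun hR => by
    have h := finrank_endAlgebra_dvd_dim_of_isField_of_isTotallyReal hF h0 hR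
    rw [hE2, h3] at h
    omega
  obtain ⟨a, q, hq, ha⟩ := AbelianVariety.exists_mul_self_eq_neg_of_finrank_eq_two h0 hE2 hF hnR
  obtain ⟨φ, d, hd, hφ⟩ := AbelianVariety.exists_hom_comp_self_eq_neg A hq ha
  have hsum := eigenMultiplicity_add_eigenMultiplicity_neg_eq_dim A φ hd hφ
  have hpos := AbelianVariety.eigenMultiplicity_pos_of_isSimple A hA φ hd hφ (by omega)
  have h1 : eigenMultiplicity A φ (Complex.I * (Real.sqrt d : ℂ)) = 1 ∨
      eigenMultiplicity A φ (-(Complex.I * (Real.sqrt d : ℂ))) = 1 := by omega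
  exact hodgeLie_eq_lefschetz_of_ribetTypeOne exists_isReal_hodgeModel_holds hodgePQ_independent_of_hodgeModel_holds φ hd hφ hE2 h1
    (by omega) ψ

end Summit.HodgeConjecture.CorCM

end
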